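import Literature.Analysis.SpecialFunctions.JacobiThetaAGM
import Literature.Probability.RandomPlanarGeometry.RectangleModulusProofs
import HarnessLib

/-!
# The conformal modulus of a rectangle is the elliptic modular function at its aspect ratio:
# `η(D₄(r)) = λ(ir)` (Kleban–Zagier 2003, §3; Bollobás–Riordan 2006, p. 185)

Topic `Literature/Probability/RandomPlanarGeometry`. Kleban–Zagier (J. Stat. Phys. 113 (2003),
§3, first display; the cite of the tree's `KlebanZagier.modularLambdaI`) use "the classical result
for the cross-ratio": the Cardy cross-ratio of the corner-marked rectangle of aspect ratio `r` is
`λ(ir) = ϑ₂(ir)⁴/ϑ₃(ir)⁴`; Bollobás–Riordan (*Percolation*, Ch. 7 §7.1 p. 185) record the same as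
`η(r) = (1−k)²/(1+k)²` at `r = 2K(k²)/K(1−k²)` with "`η(2) ≈ 0.029437`" (`= λ(2i)`). Here it is
PROVED, for the tree's `ConformalRectangle` / `crossRatio` / uniformizing data and in the exact
quantifier shape of `rectangle_crossRatio_eq_elliptic` (`RectangleModulus.lean`):

* `rectangle_crossRatio_eq_lamR` — every uniformizing datum of `(0,w)×(0,h)` with corners marked
  `ih, 0, w, w+ih` has `crossRatio x = λ(i·w/h)` (`KlebanZagier.lamR (w/h)`, equivalently
  `modularLambdaI (w/h)`, `rectangle_crossRatio_eq_modularLambdaI`).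

Proof: with `y = 2h/w` and `k = √λ(iy)`, Jacobi's inversion theorem
(`JacobiThetaAGM.lean`: `ellipticK_one_sub_lamR`, `K(1−k²) = y·K(k²)`) makes `w/h = 2K(k²)/K(1−k²)`,
so the tree's `rectangle_crossRatio_eq_elliptic_holds` gives `crossRatio = ((1−k)/(1+k))²`, and
`(1−k)/(1+k) = √λ(2i/y) = √λ(i·w/h)` by Landen's transformation of the modulus composed with the
`S`-law (`one_sub_sqrt_lamR_div`). No named fact is introduced.

## References

* P. Kleban, D. Zagier, *Crossing probabilities and modular forms*, J. Stat. Phys. 113 (2003),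
  431–454, §3 (first display: `λ` as the cross-ratio of the rectangle). [KlebanZagier2003]
* B. Bollobás, O. Riordan, *Percolation*, CUP (2006), Ch. 7 §7.1, p. 185. [BollobasRiordan2006]
* D. F. Lawden, *Elliptic Functions and Applications* (1989), §1.8, §2.2. [Lawden1989]
-/

noncomputable section

open Set Complex
open UpperHalfPlane (upperHalfPlaneSet)

namespace Literature.Probability.RandomPlanarGeometry

open KlebanZagier Literature.Analysis.SpecialFunctions

/-- **The Cardy cross-ratio of the corner-marked rectangle `(0,w)×(0,h)` is `λ(i·w/h)`**
(Kleban–Zagier 2003 §3, "the classical result for the cross-ratio"; Bollobás–Riordan p. 185).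
[cite: KlebanZagier2003, §3] -/
theorem rectangle_crossRatio_eq_lamR (R : ConformalRectangle) {w h : ℝ} (hw : 0 < w) (hh : 0 < h)
    (hcar : R.carrier = (Ioo (0:ℝ) w ×ℂ Ioo (0:ℝ) h))
    (hpt : R.pt 0 = (h:ℂ) * Complex.I ∧ R.pt 1 = 0 ∧ R.pt 2 = (w:ℂ) ∧
      R.pt 3 = (w:ℂ) + (h:ℂ) * Complex.I)
    (φ : ConformalEquiv upperHalfPlaneSet R.carrier) (x : Fin 4 → ℝ) (hφx : R.IsUniformizing φ x) :
    crossRatio x = lamR (w / h) := by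
  have hr : 0 < w / h := div_pos hw hh
  set y : ℝ := 2 * (w / h)⁻¹ with hy
  have hy0 : 0 < y := by positivity
  have hl := lamR_mem_Ioo hy0
  set k := Real.sqrt (lamR y) with hk
  have hk0 : 0 < k := Real.sqrt_pos.mpr hl.1
  have hk1 : k < 1 := by
    rw [hk, show (1:ℝ) = Real.sqrt 1 by simp]
    exact Real.sqrt_lt_sqrt hl.1.le hl.2
  have hksq : k ^ 2 = lamR y := Real.sq_sqrt hl.1.le
  have hKK : ellipticK (1 - k ^ 2) = y * ellipticK (k ^ 2) := by
    rw [hksq]; exact ellipticK_one_sub_lamR hy0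
  have hKp : 0 < ellipticK (k ^ 2) := ellipticK_pos (sq_nonneg _) (by nlinarith)
  have hratio : w / h = 2 * ellipticK (k ^ 2) / ellipticK (1 - k ^ 2) := by
    rw [hKK, hy]
    field_simp
  have hcr := rectangle_crossRatio_eq_elliptic_holds k hk0 hk1 R w h hw hh hratio hcar hpt φ x hφx
  have h2y : 2 * y⁻¹ = w / h := by rw [hy]; field_simp
  rw [hcr, ← div_pow, hk, one_sub_sqrt_lamR_div hy0, h2y, Real.sq_sqrt (lamR_mem_Ioo hr).1.le]

/-- The same with the tree's `modularLambdaI`: `crossRatio x = modularLambdaI (w/h)` — the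
identification behind `KlebanZagier.cardyPi r = cardyFunction (modularLambdaI r)` as Cardy's
crossing probability of the rectangle of aspect ratio `r`. [cite: KlebanZagier2003, §3] -/
theorem rectangle_crossRatio_eq_modularLambdaI (R : ConformalRectangle) {w h : ℝ} (hw : 0 < w)
    (hh : 0 < h) (hcar : R.carrier = (Ioo (0:ℝ) w ×ℂ Ioo (0:ℝ) h))
    (hpt : R.pt 0 = (h:ℂ) * Complex.I ∧ R.pt 1 = 0 ∧ R.pt 2 = (w:ℂ) ∧
      R.pt 3 = (w:ℂ) + (h:ℂ) * Complex.I)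
    (φ : ConformalEquiv upperHalfPlaneSet R.carrier) (x : Fin 4 → ℝ) (hφx : R.IsUniformizing φ x) :
    crossRatio x = modularLambdaI (w / h) := by
  rw [modularLambdaI_eq_lamR (div_pos hw hh)]
  exact rectangle_crossRatio_eq_lamR R hw hh hcar hpt φ x hφx

end Literature.Probability.RandomPlanarGeometry
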